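/-
# Graph equations — the translation plumbing (`TranslatesPlumbing` PROVED)

Supporting kernel for the crux `MultiplicityReduction` of route `GraphEquations`
(hand 1 = `BoundedOrderPurification` at `K = 2`, beneath the registered line `purisplit`).
M17b (`GraphEquationsUntwistingResidual`) closed the BOUNDED-TWIST class modulo the named ROUTINE
statement `TranslatesPlumbing`; this file DISCHARGES it (system-level assembly over the one-translate
programs of `GraphEquationsTranslationCircuits`), so the class is closed by a theorem and the
assembly of M17b needs only the windowed residual.  No sorry.
-/
import Mathlib
import Summits.MatrixMultiplication.Statement
import Summits.MatrixMultiplication.MatrixMultiplication.Theorems.GraphEquationsTranslationCircuits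

/-!
# The construction (the system)

Given `E` and a list `Δ` of base translations, `translSystem E Δ` has the gates of `E` first, then
one shifted block `translBlock E δ = translCircuit E.circuit (supportList δ)` per `δ ∈ Δ`
(`translGates`; earlier values survive — `getD_gateValues_translGates_of_lt` — and the block of `δ`
holds `translate δ (t_j)` at the index `translIdx` — `getD_gateValues_translGates_translIdx`), and
lists as tests the old test indices (junk ones sent to the out-of-range index) and, per `δ`, the
translated copies (`translTests`, bookkeeping invariant `translTests_spec`):

* `isFanInTwo_translSystem`, **`translatesTo_translSystem`** (`E.TranslatesTo Δ (translSystem E Δ)`),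
  `cost_translSystem_le` (`≤ (|Δ|+1)·cost E + 4·n·s·|Δ|` when every `δ ∈ Δ` has support `≤ s`;
  exact count `length_translGates`: `cost E + Σ_δ ((n+1)·|supp δ| + cost E)`);
* **`translatesPlumbing : TranslatesPlumbing`**;
* corollaries with the plumbing hypothesis discharged: `exists_reduced_deflation_of_boundedTwist'`
  (THE BOUNDED-TWIST CLASS IS CLOSED: a correct order-`2` pair of bounded twist `(T₀, s₀)` has a
  correct deflation reduced at `graphPoint y` of cost `≤ 4·((T₀+1)·cost E + 4·n·s₀·T₀) + n²`),
  `boundedOrderPurification_two_of_unboundedTwist` (rung `2` of BOP′ from the WINDOWED residual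
  `UnboundedTwistCorrDeflation K₀ T₀ s₀` ALONE) and its unwindowed form (the NEC check under `S` is
  the tree's `nec_boundedOrderPurification_two`; the residual is VACUOUS in the window under `S`, as
  every windowed residual of this line).

References: Bürgisser 2000, Rem. 2.7; BCS97 Problem 16.3; Künnemann 2018 (arXiv:1806.09189).
-/

open scoped BigOperators

noncomputable section

set_option linter.dupNamespace false

namespace Summit.MatrixMultiplication.MatrixMultiplication.Theorems.GraphEquations

open MvPolynomial Literature.Computability.AlgebraicComplexity
open Literature.Computability.AlgebraicComplexity.ArithCircuit

variable {n : ℕ}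


/-! ## The translated system -/

namespace EqSystem

/-- The block of one base translation: the program of `E` translated by the pieces of `δ`. -/
def translBlock (E : EqSystem n) (δ : MatMulVars n → ℂ) : ArithCircuit ℂ (GraphVars n) :=
  translCircuit E.circuit (supportList δ)

/-- The gates: those of `E`, then one shifted block per `δ ∈ Δ` (the head appended last). -/
def translGates (E : EqSystem n) : List (MatMulVars n → ℂ) → List (Gate ℂ (GraphVars n))
  | [] => E.circuit.gates
  | δ :: Δ => translGates E Δ ++ (E.translBlock δ).gates.map (Gate.shift (translGates E Δ).length)

/-- The index of the translated copy of gate `j` of `E` in the block of the head `δ`. -/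
def translIdx (E : EqSystem n) (Δ : List (MatMulVars n → ℂ)) (δ : MatMulVars n → ℂ) (j : ℕ) : ℕ :=
  (translGates E Δ).length + ((n + 1) * (supportList δ).length + j)

/-- The tests: those of `E` (junk indices sent to `junk`), then per `δ` the translated copies. -/
def translTests (E : EqSystem n) (junk : ℕ) : List (MatMulVars n → ℂ) → List ℕ
  | [] => E.tests.map fun j => if j < E.cost then j else junk
  | δ :: Δ => translTests E junk Δ ++ E.tests.map fun j => if j < E.cost then E.translIdx Δ δ j else junk

/-- **THE TRANSLATED SYSTEM** realising the tests of `E` and their `Δ`-translates. -/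
def translSystem (E : EqSystem n) (Δ : List (MatMulVars n → ℂ)) : EqSystem n where
  circuit := { gates := translGates E Δ, output := .const 0 }
  tests := translTests E (translGates E Δ).length Δ

/-- Cost of the translated system (exact). -/
theorem length_translGates (E : EqSystem n) (Δ : List (MatMulVars n → ℂ)) :
    (translGates E Δ).length = E.cost + (Δ.map fun δ => (n + 1) * (supportList δ).length + E.cost).sum := by
  induction Δ with
  | nil => rfl
  | cons δ Δ ih =>
    simp only [translGates, List.length_append, List.length_map, ih, List.map_cons, List.sum_cons]
    have : (E.translBlock δ).gates.length = (n + 1) * (supportList δ).length + E.cost :=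
      size_translCircuit E.circuit (supportList δ)
    rw [this]; ring

/-- The gates of `E` come first. -/
theorem cost_le_length_translGates (E : EqSystem n) (Δ : List (MatMulVars n → ℂ)) :
    E.cost ≤ (translGates E Δ).length := by
  rw [length_translGates]; exact Nat.le_add_right _ _

/-- **Cost bound**: `≤ (|Δ|+1)·cost E + 4·n·s·|Δ|` when every support has `≤ s` entries. -/
theorem length_translGates_le (E : EqSystem n) {Δ : List (MatMulVars n → ℂ)} {s : ℕ}
    (hs : ∀ δ ∈ Δ, (Function.support δ).ncard ≤ s) :
    (translGates E Δ).length ≤ (Δ.length + 1) * E.cost + 4 * n * s * Δ.length := by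
  induction Δ with
  | nil => simp [translGates, EqSystem.cost, ArithCircuit.size]
  | cons δ Δ ih =>
    have hδ : (supportList δ).length ≤ s := by
      rw [length_supportList]; exact hs δ (by simp)
    have hΔ := ih fun δ' h => hs δ' (by simp [h])
    have hblock : (E.translBlock δ).gates.length = (n + 1) * (supportList δ).length + E.cost :=
      size_translCircuit E.circuit (supportList δ)
    -- an elementary piece exists only if `n ≥ 1`
    have hn : (n + 1) * (supportList δ).length ≤ 4 * n * s := by
      rcases Nat.eq_zero_or_pos (supportList δ).length with h0 | hpos
      · rw [h0]; simp
      · have hn1 : 1 ≤ n := by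
          rcases Nat.eq_zero_or_pos n with rfl | h
          · exfalso
            obtain ⟨vc, hvc⟩ := List.exists_mem_of_length_pos hpos
            rcases vc.1 with ⟨i, _⟩ | ⟨i, _⟩ <;> exact Fin.elim0 i
          · exact h
        nlinarith
    simp only [translGates, List.length_append, List.length_map, hblock, List.length_cons]
    nlinarith

/-- Appending the next block does not change the earlier values. -/
theorem getD_gateValues_translGates_cons (E : EqSystem n) (δ : MatMulVars n → ℂ)
    (Δ : List (MatMulVars n → ℂ)) {j : ℕ} (hj : j < (translGates E Δ).length) :
    (gateValues (translGates E (δ :: Δ))).getD j 0 = (gateValues (translGates E Δ)).getD j 0 :=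
  getD_gateValues_append hj

/-- **The block values**: the translated copy of gate `j` of `E` holds `translate δ (t_j)`. -/
theorem getD_gateValues_translGates_translIdx (E : EqSystem n) (δ : MatMulVars n → ℂ)
    (Δ : List (MatMulVars n → ℂ)) (j : ℕ) :
    (gateValues (translGates E (δ :: Δ))).getD (E.translIdx Δ δ j) 0 = translate δ (E.testPoly j) := by
  rw [translGates, gateValues_append_shift, translIdx,
    List.getD_append_right _ _ _ _ (by simp), gateValues_length, Nat.add_sub_cancel_left, translBlock,
    getD_gateValues_translCircuit, deltaOf_supportList]
  rfl

/-- A translated index is in range when `j` is. -/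
theorem translIdx_lt (E : EqSystem n) (δ : MatMulVars n → ℂ) (Δ : List (MatMulVars n → ℂ)) {j : ℕ}
    (hj : j < E.cost) : E.translIdx Δ δ j < (translGates E (δ :: Δ)).length := by
  have hblock : (E.translBlock δ).gates.length = (n + 1) * (supportList δ).length + E.cost :=
    size_translCircuit E.circuit (supportList δ)
  simp only [translIdx, translGates, List.length_append, List.length_map, hblock]
  omega

/-- Lengths only grow. -/
theorem length_translGates_le_cons (E : EqSystem n) (δ : MatMulVars n → ℂ) (Δ : List (MatMulVars n → ℂ)) :
    (translGates E Δ).length ≤ (translGates E (δ :: Δ)).length := by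
  simp [translGates]

/-- **The old values survive**: gate `j < cost E` of the translated system holds `t_j`. -/
theorem getD_gateValues_translGates_of_lt (E : EqSystem n) (Δ : List (MatMulVars n → ℂ)) {j : ℕ}
    (hj : j < E.cost) : (gateValues (translGates E Δ)).getD j 0 = E.testPoly j := by
  induction Δ with
  | nil => rfl
  | cons δ Δ ih =>
    rw [getD_gateValues_translGates_cons E δ Δ (lt_of_lt_of_le hj (cost_le_length_translGates E Δ)), ih]

/-- **What the test indices point at** (the bookkeeping invariant of `translTests`). -/
theorem translTests_spec (E : EqSystem n) (junk : ℕ) (Δ : List (MatMulVars n → ℂ)) :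
    ∀ j' ∈ translTests E junk Δ,
      (j' = junk ∧ ∃ j ∈ E.tests, E.cost ≤ j) ∨
      (j' < (translGates E Δ).length ∧
        ((∃ j ∈ E.tests, (gateValues (translGates E Δ)).getD j' 0 = E.testPoly j) ∨
         (∃ δ ∈ Δ, ∃ j ∈ E.tests, (gateValues (translGates E Δ)).getD j' 0 = translate δ (E.testPoly j)))) := by
  induction Δ with
  | nil =>
    intro j' hj'
    simp only [translTests, List.mem_map] at hj'
    obtain ⟨j, hj, rfl⟩ := hj'
    by_cases hjc : j < E.cost
    · rw [if_pos hjc]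
      exact Or.inr ⟨hjc, Or.inl ⟨j, hj, rfl⟩⟩
    · rw [if_neg hjc]
      exact Or.inl ⟨rfl, j, hj, not_lt.mp hjc⟩
  | cons δ Δ ih =>
    intro j' hj'
    simp only [translTests, List.mem_append, List.mem_map] at hj'
    rcases hj' with hj' | ⟨j, hj, rfl⟩
    · rcases ih j' hj' with h | ⟨hlt, hval⟩
      · exact Or.inl h
      · refine Or.inr ⟨lt_of_lt_of_le hlt (length_translGates_le_cons E δ Δ), ?_⟩
        rw [getD_gateValues_translGates_cons E δ Δ hlt]
        rcases hval with h | ⟨δ', hδ', h⟩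
        · exact Or.inl h
        · exact Or.inr ⟨δ', List.mem_cons_of_mem δ hδ', h⟩
    · by_cases hjc : j < E.cost
      · rw [if_pos hjc]
        exact Or.inr ⟨translIdx_lt E δ Δ hjc, Or.inr ⟨δ, List.mem_cons_self, j, hj,
          getD_gateValues_translGates_translIdx E δ Δ j⟩⟩
      · rw [if_neg hjc]
        exact Or.inl ⟨rfl, j, hj, not_lt.mp hjc⟩

/-- The old in-range test indices are kept. -/
theorem mem_translTests_of_lt (E : EqSystem n) (junk : ℕ) (Δ : List (MatMulVars n → ℂ)) {j : ℕ}
    (hj : j ∈ E.tests) (hjc : j < E.cost) : j ∈ translTests E junk Δ := by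
  induction Δ with
  | nil => exact List.mem_map.mpr ⟨j, hj, by rw [if_pos hjc]⟩
  | cons δ Δ ih => exact List.mem_append_left _ ih

/-- A junk test of `E` puts `junk` on the list. -/
theorem junk_mem_translTests (E : EqSystem n) (junk : ℕ) (Δ : List (MatMulVars n → ℂ)) {j : ℕ}
    (hj : j ∈ E.tests) (hjc : ¬ j < E.cost) : junk ∈ translTests E junk Δ := by
  induction Δ with
  | nil => exact List.mem_map.mpr ⟨j, hj, by rw [if_neg hjc]⟩
  | cons δ Δ ih => exact List.mem_append_left _ ih

/-- **Every translate is realised**: for `δ ∈ Δ` and an in-range test `j`, some listed index holds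
`translate δ (t_j)`. -/
theorem exists_mem_translTests_translate (E : EqSystem n) (junk : ℕ) (Δ : List (MatMulVars n → ℂ))
    {δ : MatMulVars n → ℂ} (hδ : δ ∈ Δ) {j : ℕ} (hj : j ∈ E.tests) (hjc : j < E.cost) :
    ∃ j' ∈ translTests E junk Δ, j' < (translGates E Δ).length ∧
      (gateValues (translGates E Δ)).getD j' 0 = translate δ (E.testPoly j) := by
  induction Δ with
  | nil => simp at hδ
  | cons δ' Δ ih =>
    rcases List.mem_cons.mp hδ with rfl | hδ
    · refine ⟨E.translIdx Δ δ j, ?_, translIdx_lt E δ Δ hjc, getD_gateValues_translGates_translIdx E δ Δ j⟩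
      exact List.mem_append_right _ (List.mem_map.mpr ⟨j, hj, by rw [if_pos hjc]⟩)
    · obtain ⟨j', hj', hlt, hval⟩ := ih hδ
      exact ⟨j', List.mem_append_left _ hj', lt_of_lt_of_le hlt (length_translGates_le_cons E δ' Δ),
        by rw [getD_gateValues_translGates_cons E δ' Δ hlt, hval]⟩

/-- The test polynomials of the translated system are the gate values. -/
theorem translSystem_testPoly (E : EqSystem n) (Δ : List (MatMulVars n → ℂ)) (j' : ℕ) :
    (E.translSystem Δ).testPoly j' = (gateValues (translGates E Δ)).getD j' 0 := rfl

/-- The cost of the translated system. -/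
theorem translSystem_cost (E : EqSystem n) (Δ : List (MatMulVars n → ℂ)) :
    (E.translSystem Δ).cost = (translGates E Δ).length := rfl

/-- The junk index is the zero polynomial. -/
theorem translSystem_testPoly_junk (E : EqSystem n) (Δ : List (MatMulVars n → ℂ)) :
    (E.translSystem Δ).testPoly (translGates E Δ).length = 0 :=
  testPoly_eq_zero_of_le le_rfl

/-- **The translated system has fan-in two.** -/
theorem isFanInTwo_translSystem {E : EqSystem n} (hfan : E.circuit.IsFanInTwo) (Δ : List (MatMulVars n → ℂ)) :
    (E.translSystem Δ).circuit.IsFanInTwo := by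
  show ∀ g ∈ translGates E Δ, g.fanIn ≤ 2
  induction Δ with
  | nil => exact hfan
  | cons δ Δ ih =>
    intro g hg
    simp only [translGates, List.mem_append, List.mem_map] at hg
    rcases hg with hg | ⟨g', hg', rfl⟩
    · exact ih g hg
    · rw [Gate.fanIn_shift]
      exact isFanInTwo_translCircuit hfan (supportList δ) g' hg'

/-- **The translated system realises exactly the tests of `E` and their `Δ`-translates.** -/
theorem translatesTo_translSystem (E : EqSystem n) (Δ : List (MatMulVars n → ℂ)) :
    E.TranslatesTo Δ (E.translSystem Δ) := by
  refine ⟨fun j hj => ?_, fun δ hδ j hj => ?_, fun j' hj' => ?_⟩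
  · by_cases hjc : j < E.cost
    · exact ⟨j, mem_translTests_of_lt E _ Δ hj hjc, by
        rw [translSystem_testPoly, getD_gateValues_translGates_of_lt E Δ hjc]⟩
    · exact ⟨_, junk_mem_translTests E _ Δ hj hjc, by
        rw [translSystem_testPoly_junk, testPoly_eq_zero_of_le (not_lt.mp hjc)]⟩
  · by_cases hjc : j < E.cost
    · obtain ⟨j', hj', -, hval⟩ := exists_mem_translTests_translate E (translGates E Δ).length Δ hδ hj hjc
      exact ⟨j', hj', by rw [translSystem_testPoly, hval]⟩
    · exact ⟨_, junk_mem_translTests E _ Δ hj hjc, by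
        rw [translSystem_testPoly_junk, testPoly_eq_zero_of_le (not_lt.mp hjc), translate_zero_right]⟩
  · rcases translTests_spec E (translGates E Δ).length Δ j' hj' with ⟨rfl, j, hj, hjc⟩ | ⟨-, hval⟩
    · exact Or.inl ⟨j, hj, by rw [translSystem_testPoly_junk, testPoly_eq_zero_of_le hjc]⟩
    · rcases hval with ⟨j, hj, h⟩ | ⟨δ, hδ, j, hj, h⟩
      · exact Or.inl ⟨j, hj, by rw [translSystem_testPoly, h]⟩
      · exact Or.inr ⟨δ, hδ, j, hj, by rw [translSystem_testPoly, h]⟩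

/-- **Cost of the translated system.** -/
theorem cost_translSystem_le (E : EqSystem n) {Δ : List (MatMulVars n → ℂ)} {s : ℕ}
    (hs : ∀ δ ∈ Δ, (Function.support δ).ncard ≤ s) :
    (E.translSystem Δ).cost ≤ (Δ.length + 1) * E.cost + 4 * n * s * Δ.length :=
  length_translGates_le E hs

end EqSystem

/-! ## `TranslatesPlumbing` proved, and the corollaries -/

/-- **`TranslatesPlumbing` HOLDS** (the ROUTINE plumbing statement of M17b, discharged). -/
theorem translatesPlumbing : TranslatesPlumbing := fun _ E Δ _ hfan hs =>
  ⟨E.translSystem Δ, EqSystem.isFanInTwo_translSystem hfan Δ, EqSystem.translatesTo_translSystem E Δ,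
    EqSystem.cost_translSystem_le E hs⟩

namespace EqSystem

/-- **THE BOUNDED-TWIST CLASS IS CLOSED** (no hypothesis left): a correct pair, ideal-initial-isolated
of order `2` over `y`, of bounded twist `(T₀, s₀)` over `y`, has a correct deflation reduced at
`graphPoint y` of cost `≤ 4·((T₀+1)·cost E + 4·n·s₀·T₀) + n²`. -/
theorem exists_reduced_deflation_of_boundedTwist' {T₀ s₀ : ℕ} {E : EqSystem n} {y : MatMulVars n → ℂ}
    (hE : E.Correct) (hiso : E.IdealInitIsolatedAt 2 y) (hB : E.BoundedTwist T₀ s₀ y) :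
    ∃ E'' : EqSystem n, E''.Correct ∧ E''.ReducedAt (graphPoint y) ∧
      E''.cost ≤ 4 * ((T₀ + 1) * E.cost + 4 * n * s₀ * T₀) + n * n :=
  exists_reduced_deflation_of_boundedTwist translatesPlumbing hE hiso hB

end EqSystem

/-- **ASSEMBLY, plumbing discharged**: the WINDOWED unbounded-twist residual ALONE gives rung `2`
of `BoundedOrderPurification`. -/
theorem boundedOrderPurification_two_of_unboundedTwist (K₀ T₀ s₀ : ℕ)
    (hR : ∀ β β' : ℝ, 2 ≤ β → β < β' → β' ≤ omega ℂ → UnboundedTwistCorrDeflation K₀ T₀ s₀ β β')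
    (β : ℝ) (hβ : 2 ≤ β) (hiso : EqAdmissibleIdealIso β 2) (β' : ℝ) (hββ' : β < β') :
    EqAdmissiblePure β' :=
  boundedOrderPurification_two_of_untwisting K₀ T₀ s₀ translatesPlumbing hR β hβ hiso β' hββ'

/-- The same from the unwindowed residual. -/
theorem boundedOrderPurification_two_of_unboundedTwist' (K₀ T₀ s₀ : ℕ)
    (hR : ∀ β β' : ℝ, 2 ≤ β → β < β' → UnboundedTwistCorrDeflation K₀ T₀ s₀ β β')
    (β : ℝ) (hβ : 2 ≤ β) (hiso : EqAdmissibleIdealIso β 2) (β' : ℝ) (hββ' : β < β') :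
    EqAdmissiblePure β' :=
  boundedOrderPurification_two_of_untwisting' K₀ T₀ s₀ translatesPlumbing hR β hβ hiso β' hββ'

/- NEC check of the split: with the plumbing a theorem, the statement «under `S` the rung follows»
is literally the tree's `nec_boundedOrderPurification_two` (M16a, `GraphEquationsFlatDeflation`) —
not restated here (dedup); the windowed residual itself is `nec_unboundedTwistCorrDeflation_window`
(VACUOUS in the window under `S`). -/

end Summit.MatrixMultiplication.MatrixMultiplication.Theorems.GraphEquations

end
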